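import Mathlib
import Summits.QuantumAdvantage.QuantumAdvantage.Theorems.MobiusLadderDigitPolyUniformityChirpInd
import Summits.QuantumAdvantage.QuantumAdvantage.Theorems.MobiusLadderDigitPolyUniformityChirpNoSmallRelation
import Summits.QuantumAdvantage.QuantumAdvantage.Theorems.MobiusLadderDigitPolyUniformityChirpKronecker
import Summits.QuantumAdvantage.QuantumAdvantage.Theorems.MobiusLadderDigitPolyUniformityChirpBalanceDefect
import Summits.QuantumAdvantage.QuantumAdvantage.Theorems.MobiusLadderDigitPolyUniformityChirpLiftBasic
import Summits.QuantumAdvantage.QuantumAdvantage.Theorems.MobiusLadderDigitPolyUniformityChirpLiftClassSum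
import Summits.QuantumAdvantage.QuantumAdvantage.Theorems.MobiusLadderDigitPolyUniformityChirpLiftOddDefect
import Summits.QuantumAdvantage.QuantumAdvantage.Theorems.MobiusLadderDigitPolyUniformityChirpInterp
import Summits.QuantumAdvantage.QuantumAdvantage.Theorems.MobiusLadderDigitPolyUniformityChirpDefectPeriodic
import Summits.QuantumAdvantage.QuantumAdvantage.Theorems.MobiusLadderDigitPolyUniformityChirpCorrLe
import HarnessLib

/-!
# Crux `DigitPolyUniformity` (stmt-QuantumAdvantage-1392), line `Sketch` — cycle 6 (seat c6):
# the WIDE ×p-rigidity hypothesis is FALSE — bottom-end (2-adic) chirps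

`Theorems/…RigidityGlueWide` (p138984, `inapprox_range_of_rigidity_wide`) derived the weak target W of the `AC⁰[⊕]`
rung from the hypothesis

  RigidityWide := `∃ C C' η ρ, 0<η ∧ 0<ρ ∧ ∀ A h₀, ∀ᶠ n, ∀ P, deg P ≤ (log₂ n)^A →
     (∀ p prime ≤ C, #{1 ≤ m < 2ⁿ/p : χ_P(pm) = χ_P(m)} ≤ η2ⁿ) →
     ∃ h, h₀ ≤ h ∧ h + h₀ ≤ n ∧ ∃ g 1-bounded, ρ2ⁿ ≤ |Σ_{N<2ⁿ} χ_P(N) g(N mod 2^{C'}, ⌊N/2^h⌋)|`,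

a conjecture of this line.  It is false, for a reason the line must absorb: the BOTTOM depth `C'` of the tests is fixed
before the polynomial is chosen.  The near-solutions of λ's functional equations `F(pm) = −F(m)` (`p ≤ C`) that live in
the LOW digits are the 2-adic analogues of the Benford chirps `sgn cos(2πk log₂ m)`: with `log₅` the 2-adic discrete
logarithm (`u ≡ ±5^{ind u} (mod 2^k)` for odd `u`),

  `F(N) = (−1)^{v₂(N)} · s(a · ind(odd part of N) mod 2^{k−2})`,  `s` = square wave, `a` odd with
  `a · ind(p)/2^{k−2} ≈ 1/2 (mod 1)` for every odd prime `p ≤ C` (simultaneous inhomogeneous approximation in `ℤ/2^{k−3}`,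
  possible because the 2-adic logarithms of the odd primes `≤ C` satisfy no small linear relation — unique factorisation),

truncated at `v₂(N) < V`, is a `±1`-function of the `K = V + k` lowest binary digits (a polynomial of degree `≤ K`, a
constant), has ×p-defect `≤ η2ⁿ` for every prime `p ≤ C` (exactly `0` for `p = 2` up to the truncation), and is EXACTLY
balanced on every residue class modulo `2^{C'}` as soon as `k > C'`, hence orthogonal to every test
`g(N mod 2^{C'}, ⌊N/2^h⌋)`, `h ≥ K`.  (The NARROW form `Theorems/…RigidityGlue`, p138143, whose tests have bottom depth `k`
with `(k+m)^3 ≤ n`, catches these chirps and survives.)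

This file is the composition: the ten stubs of the cycle-6 section of `Cruxes/DigitPolyUniformity/Lines/SketchLAR.lean`
are the imported `Theorems/…Chirp*` files (`stub_ind` 2-adic logarithm, `stub_noSmallRelation` unique factorisation,
`stub_kronecker` Fejér kernel, `stub_chirp` balance/defect of the chirp, `stub_lift_*` the lift to `ℤ/2^K`,
`stub_interp` interpolation, `stub_defect_periodic`, `stub_corr_le`); here `exists_chirp` assembles the near-solution
and `rigidityWide_false` refutes the hypothesis.  What is deliberately NOT here: the repaired (two-family) rigidity
statement and its glue, which go to a separate file.
-/

noncomputable section

namespace Summit.QuantumAdvantage.DigitPolyUniformity.SketchLAR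

open Filter Finset

namespace Chirp

/-! ### The low-digit near-solution -/

/-- **The bottom-end chirp.** For all `C, C'` and `δ > 0` there are a depth `K ≥ C'` and a `±1`-function `f` of
`N mod 2^K` whose ×p-defect `#{r < 2^K : f(pr) = f(r)}` is `≤ δ2^K` for every prime `p ≤ C` and whose class sums modulo
`2^{C'}` have total size `≤ δ2^K`.  Composition of stubs A–E. [folklore] -/
theorem exists_chirp (C C' : ℕ) (δ : ℝ) (hδ : 0 < δ) :
    ∃ K : ℕ, C' ≤ K ∧ ∃ f : ℕ → ℝ, (∀ r, f r = 1 ∨ f r = -1) ∧ (∀ r, f (r % 2 ^ K) = f r) ∧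
      (∀ p : ℕ, p.Prime → p ≤ C →
        ((((range (2 ^ K)).filter (fun r => f (p * r) = f r)).card : ℕ) : ℝ) ≤ δ * 2 ^ K) ∧
      ∑ r₀ ∈ range (2 ^ C'), |∑ r ∈ (range (2 ^ K)).filter (fun r => r % 2 ^ C' = r₀), f r| ≤
        δ * 2 ^ K := by
  -- parameters `V`, `δ₂`, `S`, `L`, `k`
  obtain ⟨V, hVC', hV1, hVδ⟩ : ∃ V : ℕ, C' ≤ V ∧ 1 ≤ V ∧ 4 / δ ≤ (2 : ℝ) ^ V := by
    refine ⟨⌈4 / δ⌉₊ + C' + 1, by omega, by omega, ?_⟩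
    calc 4 / δ ≤ ⌈4 / δ⌉₊ := Nat.le_ceil _
      _ ≤ ((⌈4 / δ⌉₊ + C' + 1 : ℕ) : ℝ) := by
          exact_mod_cast (by omega : ⌈4 / δ⌉₊ ≤ ⌈4 / δ⌉₊ + C' + 1)
      _ ≤ (2 : ℝ) ^ (⌈4 / δ⌉₊ + C' + 1) := by exact_mod_cast Nat.lt_two_pow_self.le
  set δ₂ : ℝ := δ / 4 with hδ₂
  have hδ₂pos : 0 < δ₂ := by positivity
  set S : Finset ℕ := (range (C + 1)).filter (fun p => p.Prime ∧ Odd p) with hSdef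
  have hS : ∀ p ∈ S, p.Prime ∧ Odd p := fun p hp => (mem_filter.1 hp).2
  set L : ℕ := ⌊(S.card : ℝ) / (4 * δ₂ ^ 2)⌋₊ + 1 with hLdef
  have hL : (S.card : ℝ) < 4 * δ₂ ^ 2 * L := by
    have h4 : (0 : ℝ) < 4 * δ₂ ^ 2 := by positivity
    have := Nat.lt_floor_add_one ((S.card : ℝ) / (4 * δ₂ ^ 2))
    rw [div_lt_iff₀ h4] at this
    calc (S.card : ℝ) < (⌊(S.card : ℝ) / (4 * δ₂ ^ 2)⌋₊ + 1) * (4 * δ₂ ^ 2) := this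
      _ = 4 * δ₂ ^ 2 * L := by rw [hLdef]; push_cast; ring
  set X : ℕ := (∏ p ∈ S, p) ^ (2 * L) with hXdef
  set k : ℕ := X + C' + V + 3 with hkdef
  have hk3 : 3 ≤ k := by omega
  have hXlt : X < 2 ^ (k - 1) :=
    calc X < 2 ^ X := Nat.lt_two_pow_self
      _ ≤ 2 ^ (k - 1) := Nat.pow_le_pow_right (by norm_num) (by omega)
  -- Stub A: the 2-adic logarithm
  obtain ⟨ind, hlt, hper, hpm, hhom, hbij⟩ := stub_ind k (by omega)
  -- Stub C in `ℤ/2^(k-3)` with the no-relation input of Stub B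
  set M' : ℕ := 2 ^ (k - 3) with hM'
  have hM'pos : 0 < M' := Nat.two_pow_pos _
  have hMM' : (2 : ℕ) ^ (k - 2) = 2 * M' := by
    rw [hM', show k - 2 = (k - 3) + 1 by omega, pow_succ']
  have hnorel : ∀ c : S → ℤ, (∀ i, |c i| < L) → ((M' : ℤ) ∣ ∑ i, c i * (ind i : ℤ)) → c = 0 := by
    intro c hcL hdiv
    set c' : ℕ → ℤ := fun p => if hp : p ∈ S then 2 * c ⟨p, hp⟩ else 0 with hc'
    have hsum : ∑ p ∈ S, c' p * (ind p : ℤ) = 2 * ∑ i : S, c i * (ind i : ℤ) := by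
      rw [Finset.mul_sum, ← Finset.sum_coe_sort S]
      refine Finset.sum_congr rfl fun i _ => ?_
      rw [hc']
      simp only [i.2, dite_true]
      ring
    have hrel : ((2 ^ (k - 2) : ℕ) : ℤ) ∣ ∑ p ∈ S, c' p * (ind p : ℤ) := by
      rw [hsum, hMM']
      push_cast
      exact mul_dvd_mul_left 2 hdiv
    have hc'L : ∀ p ∈ S, |c' p| ≤ ((2 * L : ℕ) : ℤ) := by
      intro p hp
      rw [hc']
      simp only [hp, dite_true]
      have := hcL ⟨p, hp⟩
      rw [abs_mul]
      push_cast
      nlinarith [abs_nonneg (c ⟨p, hp⟩), abs_two (α := ℤ)]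
    have hzero := stub_noSmallRelation k ind hlt hpm hhom S hS (2 * L) (by rw [← hXdef]; exact hXlt)
      c' hc'L hrel
    funext i
    have := hzero i i.2
    rw [hc'] at this
    simp only [i.2, dite_true] at this
    simpa using this
  have hcard : (Fintype.card S : ℝ) < 4 * δ₂ ^ 2 * L := by
    rw [Fintype.card_coe]; exact hL
  obtain ⟨b, _hbM, hb⟩ := stub_kronecker M' hM'pos (fun i : S => (ind i : ℤ))
    (fun i : S => 1 / 2 - (ind i : ℝ) / 2 ^ (k - 2)) δ₂ hδ₂pos L hcard hnorel
  -- Stub D: the chirp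
  set φ : ℕ → ℝ := fun u => if (2 * b + 1) * ind u % 2 ^ (k - 2) < 2 ^ (k - 3) then 1 else -1 with hφdef
  obtain ⟨hbal, hdefφ⟩ := stub_chirp k hk3 ind hhom hbij b φ (fun u => rfl)
  have hφ1 : ∀ u, φ u = 1 ∨ φ u = -1 := fun u => by
    simp only [hφdef]; split_ifs <;> simp
  have hφper : ∀ u, φ (u % 2 ^ k) = φ u := fun u => by
    simp only [hφdef, hper]
  have happrox : ∀ p ∈ S, ∃ m : ℤ, |((2 * b + 1 : ℕ) : ℝ) * ind p / 2 ^ (k - 2) - 1 / 2 - m| ≤ δ₂ := by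
    intro p hp
    obtain ⟨m, hm⟩ := hb ⟨p, hp⟩
    refine ⟨m, ?_⟩
    have h2 : (2 : ℝ) ^ (k - 2) = 2 * (M' : ℝ) := by exact_mod_cast hMM'
    have hM'R : (0 : ℝ) < M' := by exact_mod_cast hM'pos
    have : ((2 * b + 1 : ℕ) : ℝ) * ind p / 2 ^ (k - 2) - 1 / 2 - m =
        (b : ℝ) * (ind p : ℤ) / M' - (1 / 2 - (ind p : ℝ) / 2 ^ (k - 2)) - m := by
      push_cast
      rw [h2]
      field_simp
      ring
    rw [this]
    exact hm
  -- Stubs E: the lift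
  set f : ℕ → ℝ := fun r =>
    if 2 ^ V ∣ r then 1 else (-1) ^ padicValNat 2 r * φ (r / 2 ^ padicValNat 2 r) with hfdef
  obtain ⟨hf0, hfv, hfper, hf1, hdef2⟩ := stub_lift_basic k V φ hφ1 hφper f (fun r => rfl)
  have hcls := stub_lift_classSum k V C' (by omega) hVC' φ hφper
    (fun j hj1 hjC' w hw => hbal j hj1 (by omega) w hw) f hf0 hfv
  -- numerics
  have h2k : (2 : ℝ) ^ (V + k) = 2 ^ V * 2 ^ k := pow_add _ _ _
  have h2kpos : (0 : ℝ) < 2 ^ k := by positivity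
  have hVk0 : (0 : ℝ) ≤ 2 ^ V * 2 ^ k := by positivity
  have hδV : 4 ≤ δ * 2 ^ V := by
    rw [div_le_iff₀ hδ] at hVδ; linarith
  have hkV : (2 : ℝ) ^ (V + 2) ≤ 2 ^ k := pow_le_pow_right₀ (by norm_num) (by omega)
  have hA : (1 : ℝ) ≤ δ / 4 * 2 ^ V := by linarith
  have hB : (2 : ℝ) ^ k ≤ δ / 4 * (2 ^ V * 2 ^ k) := by
    have := mul_le_mul_of_nonneg_right hA h2kpos.le
    rw [← mul_assoc]; linarith
  have hB' : (2 : ℝ) ^ (V + 2) ≤ δ / 4 * (2 ^ V * 2 ^ k) := hkV.trans hB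
  have hB2 : 2 * (2 : ℝ) ^ k ≤ δ * (2 ^ V * 2 ^ k) := by
    have := mul_le_mul_of_nonneg_right hδV h2kpos.le
    rw [← mul_assoc]; linarith
  refine ⟨V + k, by omega, f, hf1, hfper, ?_, ?_⟩
  · intro p hp hpC
    rcases hp.eq_two_or_odd' with rfl | hpodd
    · -- `p = 2`
      calc ((((range (2 ^ (V + k))).filter (fun r => f (2 * r) = f r)).card : ℕ) : ℝ)
          ≤ 2 ^ (k + 1) := hdef2
        _ = 2 * 2 ^ k := by ring
        _ ≤ δ * (2 ^ V * 2 ^ k) := hB2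
        _ = δ * 2 ^ (V + k) := by rw [h2k]
    · have hpS : p ∈ S := by
        rw [hSdef, mem_filter, mem_range]
        exact ⟨by omega, hp, hpodd⟩
      have hE2 := stub_lift_oddDefect k V (by omega) φ hφper f hfv p hpodd
      have hD := hdefφ p hpodd δ₂ hδ₂pos.le (happrox p hpS)
      have h2k1 : (2 : ℝ) ^ (V + 1) * 2 ^ (k - 1) = 2 ^ (V + k) := by
        rw [← pow_add]; congr 1; omega
      calc ((((range (2 ^ (V + k))).filter (fun r => f (p * r) = f r)).card : ℕ) : ℝ)
          ≤ 2 ^ (V + 1) * (((range (2 ^ k)).filter (fun u => Odd u ∧ φ (p * u) = φ u)).card : ℝ) +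
              2 ^ k := hE2
        _ ≤ 2 ^ (V + 1) * (2 * δ₂ * 2 ^ (k - 1) + 2) + 2 ^ k := by gcongr
        _ = 2 * δ₂ * (2 ^ (V + 1) * 2 ^ (k - 1)) + 2 ^ (V + 2) + 2 ^ k := by ring
        _ = δ / 2 * 2 ^ (V + k) + 2 ^ (V + 2) + 2 ^ k := by rw [h2k1, hδ₂]; ring
        _ ≤ δ / 2 * 2 ^ (V + k) + δ / 4 * (2 ^ V * 2 ^ k) + δ / 4 * (2 ^ V * 2 ^ k) := by
            linarith
        _ = δ * 2 ^ (V + k) := by rw [h2k]; ring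
  · calc ∑ r₀ ∈ range (2 ^ C'), |∑ r ∈ (range (2 ^ (V + k))).filter (fun r => r % 2 ^ C' = r₀), f r|
        ≤ 2 ^ k := hcls
      _ ≤ δ / 4 * (2 ^ V * 2 ^ k) := hB
      _ ≤ δ * 2 ^ (V + k) := by
          rw [h2k]
          have : 0 ≤ δ * (2 ^ V * 2 ^ k) := by positivity
          linarith

/-! ### RigidityWide is false -/

/-- **The WIDE ×p-rigidity hypothesis of `inapprox_range_of_rigidity_wide` (p138984) is false.**  Given
`C, C', η, ρ`, take the chirp `f` of `exists_chirp C C' (min η ρ/2)` (depth `K`), `A = 1`, `h₀ = K`; for every large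
`n` the interpolating polynomial `P` (degree `≤ K ≤ log₂ n`) has all ×p-defects `≤ η2ⁿ` (periodicity) yet correlation
`< ρ2ⁿ` with every test `g(N mod 2^{C'}, ⌊N/2^h⌋)`, `h ≥ K` (its class sums modulo `2^{C'}` are small).  What survives:
the narrow form (`Theorems/…RigidityGlue`), whose tests have growing bottom depth. [folklore] -/
theorem rigidityWide_false :
    ¬ (∃ C C' : ℕ, ∃ η ρ : ℝ, 0 < η ∧ 0 < ρ ∧ ∀ A h₀ : ℕ, ∀ᶠ n : ℕ in atTop,
      ∀ P : MvPolynomial (Fin n) (ZMod 2), P.totalDegree ≤ Nat.log 2 n ^ A →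
        (∀ p : ℕ, p.Prime → p ≤ C →
          ((((Ico 1 (2 ^ n / p)).filter fun m =>
              (if MvPolynomial.eval (fun i : Fin n => if Nat.testBit (p * m) i then (1 : ZMod 2) else 0) P = 1
                then (-1 : ℝ) else 1) =
              (if MvPolynomial.eval (fun i : Fin n => if Nat.testBit m i then (1 : ZMod 2) else 0) P = 1
                then (-1 : ℝ) else 1)).card : ℕ) : ℝ) ≤ η * 2 ^ n) →
        ∃ h : ℕ, h₀ ≤ h ∧ h + h₀ ≤ n ∧ ∃ g : ℕ → ℕ → ℝ, (∀ a b, |g a b| ≤ 1) ∧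
          ρ * 2 ^ n ≤ |∑ N ∈ range (2 ^ n),
            (if MvPolynomial.eval (fun i : Fin n => if Nat.testBit N i then (1 : ZMod 2) else 0) P = 1
              then (-1 : ℝ) else 1) * g (N % 2 ^ C') (N / 2 ^ h)|) := by
  rintro ⟨C, C', η, ρ, hη, hρ, H⟩
  set δ : ℝ := min η ρ / 2 with hδdef
  have hδpos : 0 < δ := by positivity
  have hδη : 2 * δ ≤ η := by rw [hδdef]; linarith [min_le_left η ρ]
  have hδρ : δ < ρ := by rw [hδdef]; linarith [min_le_right η ρ]
  obtain ⟨K, hC'K, f, hf1, hfper, hdef, hcls⟩ := exists_chirp C C' δ hδpos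
  obtain ⟨n, hn, hnK⟩ := ((H 1 K).and (eventually_ge_atTop (2 ^ K))).exists
  have hKn : K ≤ n := Nat.lt_two_pow_self.le.trans hnK
  obtain ⟨P, hPdeg, hPf⟩ := stub_interp K n hKn f hf1 hfper
  have hdegle : P.totalDegree ≤ Nat.log 2 n ^ 1 := by
    rw [pow_one]
    exact hPdeg.trans (Nat.le_log_of_pow_le (by norm_num) hnK)
  have h2n : (2 : ℝ) ^ n = 2 ^ (n - K) * 2 ^ K := by
    rw [← pow_add]; congr 1; omega
  have h2npos : (0 : ℝ) < 2 ^ n := by positivity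
  have hdefP : ∀ p : ℕ, p.Prime → p ≤ C →
      ((((Ico 1 (2 ^ n / p)).filter fun m =>
          (if MvPolynomial.eval (fun i : Fin n => if Nat.testBit (p * m) i then (1 : ZMod 2) else 0) P = 1
            then (-1 : ℝ) else 1) =
          (if MvPolynomial.eval (fun i : Fin n => if Nat.testBit m i then (1 : ZMod 2) else 0) P = 1
            then (-1 : ℝ) else 1)).card : ℕ) : ℝ) ≤ η * 2 ^ n := by
    intro p hp hpC
    simp_rw [hPf]
    have h1 := stub_defect_periodic f K p (2 ^ n / p) hfper
    have h2 := hdef p hp hpC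
    have h3 : 2 ^ n / p / 2 ^ K + 1 ≤ 2 * 2 ^ (n - K) := by
      have : 2 ^ n / p / 2 ^ K ≤ 2 ^ (n - K) := by
        calc 2 ^ n / p / 2 ^ K ≤ 2 ^ n / 2 ^ K := Nat.div_le_div_right (Nat.div_le_self _ _)
          _ = 2 ^ (n - K) := by rw [Nat.pow_div hKn (by norm_num)]
      have : 1 ≤ 2 ^ (n - K) := Nat.one_le_two_pow
      omega
    calc ((((Ico 1 (2 ^ n / p)).filter fun m => f (p * m) = f m).card : ℕ) : ℝ)
        ≤ (((2 ^ n / p / 2 ^ K + 1) * ((range (2 ^ K)).filter (fun r => f (p * r) = f r)).card : ℕ) : ℝ) := by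
          exact_mod_cast h1
      _ ≤ ((2 * 2 ^ (n - K) : ℕ) : ℝ) * (((range (2 ^ K)).filter (fun r => f (p * r) = f r)).card : ℝ) := by
          push_cast
          gcongr
          exact_mod_cast h3
      _ ≤ ((2 * 2 ^ (n - K) : ℕ) : ℝ) * (δ * 2 ^ K) := by gcongr
      _ = 2 * δ * 2 ^ n := by push_cast; rw [h2n]; ring
      _ ≤ η * 2 ^ n := by nlinarith
  obtain ⟨h, hKh, hhn, g, hg, hcorr⟩ := hn P hdegle hdefP
  have hbound := stub_corr_le f g C' K h n hC'K hKh hKn hfper hg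
  simp_rw [hPf] at hcorr
  have : ρ * 2 ^ n ≤ δ * 2 ^ n :=
    calc ρ * 2 ^ n ≤ |∑ N ∈ range (2 ^ n), f N * g (N % 2 ^ C') (N / 2 ^ h)| := hcorr
      _ ≤ 2 ^ (n - K) * ∑ r₀ ∈ range (2 ^ C'),
            |∑ r ∈ (range (2 ^ K)).filter (fun r => r % 2 ^ C' = r₀), f r| := hbound
      _ ≤ 2 ^ (n - K) * (δ * 2 ^ K) := by gcongr
      _ = δ * 2 ^ n := by rw [h2n]; ring
  nlinarith

end Chirp

end Summit.QuantumAdvantage.DigitPolyUniformity.SketchLAR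

end
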